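import Summits.QuantumAdvantage.QuantumAdvantage.Theorems.WbwObfuscatedGluedTreesKowNbrPrp

/-!
# Toolkit stub `toolkit_prpSymm` — the INVERSE of the keyed four-round Feistel permutation ON CODES
# (crux `WbwObfuscatedGluedTrees`, stmt-QuantumAdvantage-2340; line `knowledge-of-walk-split`, stage 3, piece G2b of `NbrBitFP`)

Companion of `Theorems/WbwObfuscatedGluedTreesKowNbrPrp.lean` (stub `toolkit_prp`), whose list-level round machinery
it imports: every Feistel round `feistelPerm S F` of `Literature/Computability/Cryptography/ObfuscatedGluedTrees.lean`
§4 is an involution, so `(prp P μ k d).symm w = F₀ (F₁ (F₂ (F₃ w)))` is the same four list rounds in reverse order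
(`prpKit_ofFn_prp_symm`); the map `(1^μ, k, 1^d, w) ↦ List.ofFn ((prp P μ k d).symm (fun i => w.getD i false))` is
therefore computed on codes by the same programme with the rounds re-ordered (`prpKit_roundFP` four times on
`fit d w`, masks `prpKit_highMaskFP` / `prpKit_lowMaskFP`), from the PRF's evaluation map on codes (`hP`).
[folklore]
-/

set_option linter.dupNamespace false

noncomputable section

namespace Summit.QuantumAdvantage.QuantumAdvantage.Theorems.WbwObfuscatedGluedTrees.KnowledgeOfWalk.Generator

open Literature.Computability.Cryptography Literature.Computability.Complexity
open Literature.Computability.Cryptography.ObfuscatedGluedTrees Literature.Computability.QuantumComplexity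
open Literature.Computability.Complexity.CodeFP (natE unE bitE pairE strE rawE fst snd)

/-- **TOOLKIT G2b — the inverse of the keyed Feistel permutation on codes**: `(1^μ, k, 1^d, w) ↦ (prp P μ k d).symm
(w as a d-bit vector)`, listed back as a string of length `d`: fit `w` to `d` bits, apply the four list rounds in the
order `3, 2, 1, 0` with the masks high, low, high, low, and identify the result with `List.ofFn ((prp …).symm …)` by
`prpKit_ofFn_prp_symm` / `prpKit_ofFn_getD`. [folklore] -/
theorem toolkit_prpSymm :
    ∀ (P : PuncturablePRFScheme),
      Literature.Computability.Complexity.CodeFP (pairE unE (pairE strE strE)) strE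
        (fun p : ℕ × List Bool × List Bool => P.eval p.1 p.2.1 p.2.2) →
      Literature.Computability.Complexity.CodeFP (pairE unE (pairE strE (pairE unE strE))) strE
        (fun t : ℕ × List Bool × ℕ × List Bool =>
          List.ofFn ((prp P t.1 t.2.1 t.2.2.1).symm (fun i : Fin t.2.2.1 => t.2.2.2.getD (i : ℕ) false))) := by
  intro P hP
  have pμ : CodeFP (pairE unE (pairE strE (pairE unE strE))) unE (fun t : ℕ × List Bool × ℕ × List Bool => t.1) :=
    fst _ _
  have pk : CodeFP (pairE unE (pairE strE (pairE unE strE))) strE (fun t : ℕ × List Bool × ℕ × List Bool => t.2.1) :=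
    (snd _ _).fst'
  have pd : CodeFP (pairE unE (pairE strE (pairE unE strE))) unE (fun t : ℕ × List Bool × ℕ × List Bool => t.2.2.1) :=
    (snd _ _).snd'.fst'
  have pw : CodeFP (pairE unE (pairE strE (pairE unE strE))) strE (fun t : ℕ × List Bool × ℕ × List Bool => t.2.2.2) :=
    (snd _ _).snd'.snd'
  have hL : CodeFP (pairE unE (pairE strE (pairE unE strE))) strE
      (fun t : ℕ × List Bool × ℕ × List Bool => List.ofFn (lowHalf t.2.2.1)) :=
    prpKit_lowMaskFP.comp pd
  have hH : CodeFP (pairE unE (pairE strE (pairE unE strE))) strE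
      (fun t : ℕ × List Bool × ℕ × List Bool => List.ofFn (highHalf t.2.2.1)) :=
    prpKit_highMaskFP.comp pd
  have h0 : CodeFP (pairE unE (pairE strE (pairE unE strE))) strE
      (fun t : ℕ × List Bool × ℕ × List Bool => fit t.2.2.1 t.2.2.2) :=
    FPData.fitFP.comp (pd.pair pw)
  have h1 := prpKit_roundFP P hP 3 pμ pk pd hH h0
  have h2 := prpKit_roundFP P hP 2 pμ pk pd hL h1
  have h3 := prpKit_roundFP P hP 1 pμ pk pd hH h2
  have h4 := prpKit_roundFP P hP 0 pμ pk pd hL h3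
  refine h4.congr fun t => ?_
  rw [prpKit_ofFn_prp_symm P t.1 t.2.1 (fun r M W => bxor W (List.zipWith (fun m b => m && b) M
      (prf P t.1 t.2.1 t.2.2.1 (bitsOf 8 r ++ List.zipWith (fun m b => !m && b) M W)))) (fun _ _ _ => rfl),
    prpKit_ofFn_getD]

end Summit.QuantumAdvantage.QuantumAdvantage.Theorems.WbwObfuscatedGluedTrees.KnowledgeOfWalk.Generator

end
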